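import Summits.QuantumAdvantage.QuantumAdvantage.Theorems.LinnikCubicClassGroupsDegreeOnePrimesEscapeConjInvariantShortInterval
import HarnessLib

/-!
# Chebotarev in short intervals for conjugation-invariant sets: arbitrary prime predicates (ramified primes absorbed)

Topic `Summits/QuantumAdvantage/QuantumAdvantage/Theorems`, cell B2b-1 (linnik-cubic), PART A (gen 17); helper
toward the crux `DegreeOnePrimesEscape` (stmt-QuantumAdvantage-11543) of route `LinnikCubicClassGroups`.
HONEST FRAMING: the value of this file is a THEOREM (kernel-checked, GRH-free, Siegel-free, unconditional) — NOT
summit progress.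

`conjInvariant_shortInterval_dh_congr`: the Deuring–Heilbronn-sharp short-interval Chebotarev theorem
`conjInvariant_shortInterval_dh` for a non-empty conjugation-invariant `S ⊆ Gal(N/ℚ)` holds verbatim for EVERY
prime predicate `P` that agrees with "`p ∤ d_N` and `Frob_p ∈ S`" at the primes `p ∤ d_N` (e.g. "the splitting
type of `p` in a subfield is `T`"): the two window sums differ by at most `Σ_{p ∣ d_N} log p ≤ log|d_N|`
(`abs_windowSum_sub_windowSum_le`), which is absorbed into `κ M_S` because the main term is effectively
bounded below — `M_S ≥ (h/2n)·min(1,(1−β₁) log x) ≥ (h/2n)·c₁ Q^{−2}` by `half_min_mul_le_flat` and Stark's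
`1 − β₁ ≥ c₁(n) Q^{−2}` [Stark1974, Thm. 1'] (`Residue.one_sub_realZero_ge_condQn_rpow`), while
`log|d_N| ≤ 120 n x^{3/4} ≤ (κ/4n) c₁ Q^{−2} h` in the range `x ≥ |d_N|^L` (`junk_le_quarter_mul_rel`).
This is the input for splitting-type prime number theorems in short intervals over arbitrary number fields.
References: [LagariasMontgomeryOdlyzko1979, Thm. 1.1]; [ThornerZaman2019, Thm. 3.2]; [Stark1974, Thm. 1'];
S. Gun, S. L. Naik, arXiv:2405.04698 (2024), Thm. 7.
-/

noncomputable section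

open scoped NumberField nonZeroDivisors Classical
open Finset Real Ideal NumberField IsDedekindDomain
open Literature.NumberTheory.NumberFields Literature.NumberTheory.LFunctions
  Literature.NumberTheory.LFunctions.NumberField Literature.NumberTheory.GaloisRepresentations

namespace Summit.QuantumAdvantage.QuantumAdvantage.Theorems.DegreeOnePrimesEscape

/-- **Perturbing the predicate in a window sum.**  If `P` and `Q` agree on `s₂` off `R`, `s₁ ⊆ s₂` and
`f ≥ 0`, then the window sums `Σ_{s₂, P} f − Σ_{s₁, P} f` and `Σ_{s₂, Q} f − Σ_{s₁, Q} f` differ by at most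
`Σ_{s₂, R} f`. -/
theorem abs_windowSum_sub_windowSum_le {s₁ s₂ : Finset ℕ} (hs : s₁ ⊆ s₂) (P Q R : ℕ → Prop)
    [DecidablePred P] [DecidablePred Q] [DecidablePred R] {f : ℕ → ℝ} (hf : ∀ p, 0 ≤ f p)
    (h : ∀ p ∈ s₂, ¬ R p → (P p ↔ Q p)) :
    |((∑ p ∈ s₂.filter P, f p) - ∑ p ∈ s₁.filter P, f p) -
      ((∑ p ∈ s₂.filter Q, f p) - ∑ p ∈ s₁.filter Q, f p)| ≤ ∑ p ∈ s₂.filter R, f p := by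
  simp only [Finset.sum_filter]
  rw [← Finset.sum_sdiff hs (f := fun p => if P p then f p else 0),
    ← Finset.sum_sdiff hs (f := fun p => if Q p then f p else 0),
    ← Finset.sum_sdiff hs (f := fun p => if R p then f p else 0)]
  have e : ∀ a b c d : ℝ, (a + b - b) - (c + d - d) = a - c := by intros; ring
  rw [e, ← Finset.sum_sub_distrib]
  have hR1 : 0 ≤ ∑ p ∈ s₁, (if R p then f p else 0) :=
    Finset.sum_nonneg fun p _ => by split_ifs <;> [exact hf p; exact le_rfl]
  calc |∑ p ∈ s₂ \ s₁, ((if P p then f p else 0) - (if Q p then f p else 0))|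
      ≤ ∑ p ∈ s₂ \ s₁, |(if P p then f p else 0) - (if Q p then f p else 0)| :=
        Finset.abs_sum_le_sum_abs _ _
    _ ≤ ∑ p ∈ s₂ \ s₁, (if R p then f p else 0) := by
        refine Finset.sum_le_sum fun p hp => ?_
        have hp2 : p ∈ s₂ := (Finset.mem_sdiff.mp hp).1
        by_cases hR : R p
        · rw [if_pos hR]
          have ha : 0 ≤ (if P p then f p else 0) ∧ (if P p then f p else 0) ≤ f p := by
            split_ifs <;> [exact ⟨hf p, le_rfl⟩; exact ⟨le_rfl, hf p⟩]
          have hb : 0 ≤ (if Q p then f p else 0) ∧ (if Q p then f p else 0) ≤ f p := by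
            split_ifs <;> [exact ⟨hf p, le_rfl⟩; exact ⟨le_rfl, hf p⟩]
          rw [abs_sub_le_iff]; constructor <;> linarith [ha.1, ha.2, hb.1, hb.2]
        · rw [if_neg hR]
          have hiff := h p hp2 hR
          by_cases hPp : P p
          · rw [if_pos hPp, if_pos (hiff.mp hPp), sub_self, abs_zero]
          · rw [if_neg hPp, if_neg (fun hQ => hPp (hiff.mpr hQ)), sub_self, abs_zero]
    _ ≤ (∑ p ∈ s₂ \ s₁, (if R p then f p else 0)) + ∑ p ∈ s₁, (if R p then f p else 0) := by linarith

/-- `log x ≤ (4/3) x^{3/4}` for `x > 0`. -/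
theorem log_le_four_thirds_rpow {x : ℝ} (hx : 0 < x) : Real.log x ≤ 4 / 3 * x ^ (3 / 4 : ℝ) := by
  have h1 : Real.log (x ^ (3 / 4 : ℝ)) ≤ x ^ (3 / 4 : ℝ) - 1 :=
    Real.log_le_sub_one_of_pos (Real.rpow_pos_of_pos hx _)
  rw [Real.log_rpow hx] at h1
  linarith

set_option maxHeartbeats 4000000 in
/-- **Chebotarev in short intervals for a conjugation-invariant set and an arbitrary prime predicate agreeing with
the Frobenius condition at the unramified primes** (see the module docstring): the conclusion of
`conjInvariant_shortInterval_dh` for `Σ_{x < p ≤ x+h, P p} log p`, every non-empty conjugation-invariant `S` and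
every such `P`.  Unconditional. [cite: LagariasMontgomeryOdlyzko1979, Theorem 1.1]
[cite: ThornerZaman2019, Theorem 3.2] [cite: Stark1974, Theorem 1'] -/
theorem conjInvariant_shortInterval_dh_congr (n : ℕ) (hn : 1 < n) {κ : ℝ} (hκ : 0 < κ) (hκ1 : κ ≤ 1) :
    ∃ δ L c : ℝ, 0 < δ ∧ δ ≤ 1 / 64 ∧ 0 < L ∧ 0 < c ∧ c ≤ 1 / 4 ∧ c ≤ 1 / (8 * ((2 * n).factorial : ℝ)) ∧
      ∀ (N : Type) [Field N] [NumberField N] [IsGalois ℚ N], Module.finrank ℚ N = n →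
      ∃ (θ β₁ : ℝ) (K₁ : Subgroup (N ≃ₐ[ℚ] N)), (θ = 0 ∨ θ = 1) ∧ K₁.Normal ∧
        1 - c / (Real.log ((NumberField.discr N).natAbs : ℝ) + Real.log 4) < β₁ ∧ β₁ < 1 ∧
        (θ = 1 → dedekindZeta₁ N β₁ = 0 ∧ K₁.index = 2 ∧
          ∀ H : Subgroup (N ≃ₐ[ℚ] N),
            dedekindZeta₁ (IntermediateField.fixedField H) β₁ = 0 ↔ H ≤ K₁) ∧
        (θ = 0 → K₁ = ⊤ ∧ ¬ ∃ β : ℝ, dedekindZeta₁ N β = 0 ∧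
          1 - c / (Real.log ((NumberField.discr N).natAbs : ℝ) + Real.log 4) < β ∧ β < 1) ∧
        ∀ S : Set (N ≃ₐ[ℚ] N), (∀ g g' : N ≃ₐ[ℚ] N, g ∈ S → g' * g * g'⁻¹ ∈ S) → S.Nonempty →
          ∀ (P : ℕ → Prop) [DecidablePred P],
            (∀ p : ℕ, p.Prime → ¬ ((p : ℤ) ∣ NumberField.discr N) →
              (P p ↔ ∃ (Q : Ideal (𝓞 N)) (_ : Q.IsMaximal) (_ : Q.LiesOver (span {(p : ℤ)}))
                (φ : N ≃ₐ[ℚ] N), IsArithFrobAt ℤ φ Q ∧ Q.inertia (N ≃ₐ[ℚ] N) = ⊥ ∧ φ ∈ S)) →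
          ∀ x h : ℝ, ((NumberField.discr N).natAbs : ℝ) ^ L ≤ x → x ^ (1 - δ) ≤ h → h ≤ x →
            |(∑ p ∈ (Nat.primesLE ⌊x + h⌋₊).filter P, Real.log p) -
              (∑ p ∈ (Nat.primesLE ⌊x⌋₊).filter P, Real.log p) -
              ((Nat.card S : ℝ) * h -
                θ * ((Nat.card {g : N ≃ₐ[ℚ] N // g ∈ S ∧ g ∈ K₁} : ℝ) -
                  Nat.card {g : N ≃ₐ[ℚ] N // g ∈ S ∧ g ∉ K₁}) * (((x + h) ^ β₁ - x ^ β₁) / β₁)) /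
                Nat.card (N ≃ₐ[ℚ] N)| ≤
              κ * (((Nat.card S : ℝ) * h -
                θ * ((Nat.card {g : N ≃ₐ[ℚ] N // g ∈ S ∧ g ∈ K₁} : ℝ) -
                  Nat.card {g : N ≃ₐ[ℚ] N // g ∈ S ∧ g ∉ K₁}) * (((x + h) ^ β₁ - x ^ β₁) / β₁)) /
                Nat.card (N ≃ₐ[ℚ] N)) := by
  have hn0 : (0 : ℝ) < n := by exact_mod_cast (lt_trans Nat.zero_lt_one hn)
  have hn1 : (1 : ℝ) ≤ n := by exact_mod_cast hn.le
  have hκ2 : 0 < κ / 2 := by positivity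
  have hκ21 : κ / 2 ≤ 1 := by linarith
  obtain ⟨δ, L, c, hδ0, hδ64, hL, hc, hc4, hcF, hmain⟩ := conjInvariant_shortInterval_dh n hn hκ2 hκ21
  obtain ⟨c₁, hc₁, hc₁1, heff⟩ := Residue.one_sub_realZero_ge_condQn_rpow n hn
  -- thresholds
  set κ' : ℝ := κ / n with hκ'
  have hκ'0 : 0 < κ' := by positivity
  set e : ℝ := 1 + n * Real.log n / Real.log 3 with he
  have hlog3 : 0 < Real.log 3 := Real.log_pos (by norm_num)
  have hlogn : 0 ≤ Real.log n := Real.log_nonneg hn1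
  have he0 : 0 ≤ (n : ℝ) * Real.log n / Real.log 3 := by positivity
  have he1 : 1 ≤ e := by rw [he]; linarith
  set L₃ : ℝ := max 0 (64 / 11 * Real.log (480 * n / (κ' * c₁))) with hL₃
  set L' : ℝ := max (max L 1) (max (32 * e) L₃) with hL'
  have hLL' : L ≤ L' := le_trans (le_max_left _ _) (le_max_left _ _)
  have hL'1 : 1 ≤ L' := le_trans (le_max_right _ _) (le_max_left _ _)
  have hL'32 : 32 * e ≤ L' := le_trans (le_max_left _ _) (le_max_right _ _)
  have hL'L₃ : L₃ ≤ L' := le_trans (le_max_right _ _) (le_max_right _ _)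
  have hL'0 : 0 < L' := by linarith
  refine ⟨δ, L', c, hδ0, hδ64, hL'0, hc, hc4, hcF, fun N _ _ _ hN => ?_⟩
  obtain ⟨θ, β₁, K₁, hθ, hK₁n, hβ₁c, hβ₁1, h1, h0, hS⟩ := hmain N hN
  refine ⟨θ, β₁, K₁, hθ, hK₁n, hβ₁c, hβ₁1, h1, h0, fun S hSinv hSne P _ hP x h hx hhx hhx' => ?_⟩
  have hN1 : 1 < Module.finrank ℚ N := by rw [hN]; exact hn
  set d : ℝ := ((NumberField.discr N).natAbs : ℝ) with hd
  have hd3 : (3 : ℝ) ≤ d := three_le_natAbs_discr_real N hN1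
  have hd0 : (0 : ℝ) < d := by linarith
  have hd1 : (1 : ℝ) ≤ d := by linarith
  have hG : (Nat.card (N ≃ₐ[ℚ] N) : ℝ) = n := by rw [IsGalois.card_aut_eq_finrank, hN]
  have hmono : ∀ {a b : ℝ}, a ≤ b → d ^ a ≤ d ^ b := fun hab => Real.rpow_le_rpow_of_exponent_le hd1 hab
  have hxL : d ^ L ≤ x := (hmono hLL').trans hx
  have hdx : d ≤ x := by
    have := hmono hL'1; rw [Real.rpow_one] at this; exact this.trans hx
  have hx1 : (1 : ℝ) ≤ x := by linarith
  have hx0 : 0 < x := by linarith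
  have hh0 : 0 ≤ h := (Real.rpow_pos_of_pos hx0 _).le.trans hhx
  -- `Q ≤ d^e`, `Q^32 ≤ x`, `c₁ Q^{-2} ≤ 1`
  have hQd : ThornerZaman.condQn N ≤ d ^ e := by
    have h' := condQn_le_natAbs_discr_rpow N hN1
    rw [hN] at h'; exact h'
  have hQ12 : (12 : ℝ) ≤ ThornerZaman.condQn N := ThornerZaman.twelve_le_condQn (K := N) hN1
  have hQpos : (0 : ℝ) < ThornerZaman.condQn N := by linarith
  have hQ32 : ThornerZaman.condQn N ^ (32 : ℝ) ≤ x := by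
    calc ThornerZaman.condQn N ^ (32 : ℝ) ≤ (d ^ e) ^ (32 : ℝ) := Real.rpow_le_rpow hQpos.le hQd (by norm_num)
      _ = d ^ (e * 32) := by rw [Real.rpow_mul hd0.le]
      _ ≤ d ^ L' := hmono (by linarith)
      _ ≤ x := hx
  set q : ℝ := c₁ * ThornerZaman.condQn N ^ (-(2 : ℝ)) with hq
  have hq0 : 0 < q := by positivity
  have hq1 : q ≤ 1 := by
    have h1' : ThornerZaman.condQn N ^ (-(2 : ℝ)) ≤ 1 :=
      Real.rpow_le_one_of_one_le_of_nonpos (by linarith) (by norm_num)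
    have := mul_le_mul hc₁1 h1' (Real.rpow_nonneg hQpos.le _) zero_le_one
    rw [hq]; linarith
  -- `log d ≤ (κ/(4n)) q h`
  have hlogd : Real.log d ≤ κ' / 4 * q * h := by
    have hL₃' : 64 / 11 * Real.log (480 * n / (κ' * c₁)) ≤ L' := le_trans (le_max_right _ _) hL'L₃
    have hjunk := junk_le_quarter_mul_rel (δ := δ) hn0 hκ'0 hc₁ hd3 hL₃' hL'0.le hx hQpos hQ32 hδ64 hhx
    have h34 : 0 ≤ x ^ (3 / 4 : ℝ) := Real.rpow_nonneg hx0.le _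
    calc Real.log d ≤ Real.log x := Real.log_le_log hd0 hdx
      _ ≤ 4 / 3 * x ^ (3 / 4 : ℝ) := log_le_four_thirds_rpow hx0
      _ ≤ 120 * n * x ^ (3 / 4 : ℝ) := by nlinarith
      _ ≤ κ' / 4 * q * h := hjunk
  -- the unperturbed estimate at precision `κ/2`
  have key := hS S hSinv x h hxL hhx hhx'
  set M : ℝ := ((Nat.card S : ℝ) * h -
      θ * ((Nat.card {g : N ≃ₐ[ℚ] N // g ∈ S ∧ g ∈ K₁} : ℝ) -
        Nat.card {g : N ≃ₐ[ℚ] N // g ∈ S ∧ g ∉ K₁}) * (((x + h) ^ β₁ - x ^ β₁) / β₁)) /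
      Nat.card (N ≃ₐ[ℚ] N) with hM
  -- the perturbation: `|ΔA_P − ΔS_S| ≤ Σ_{p ≤ x+h, p ∣ d_N} log p ≤ log d`
  have hsub : Nat.primesLE ⌊x⌋₊ ⊆ Nat.primesLE ⌊x + h⌋₊ := by
    intro p hp
    rw [Nat.mem_primesLE] at hp ⊢
    exact ⟨hp.1.trans (Nat.floor_le_floor (by linarith)), hp.2⟩
  have hpert : |((∑ p ∈ (Nat.primesLE ⌊x + h⌋₊).filter P, Real.log p) -
        ∑ p ∈ (Nat.primesLE ⌊x⌋₊).filter P, Real.log p) -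
      ((∑ p ∈ (Nat.primesLE ⌊x + h⌋₊).filter (fun p : ℕ => ¬ ((p : ℤ) ∣ NumberField.discr N) ∧
          ∃ (Q : Ideal (𝓞 N)) (_ : Q.IsMaximal) (_ : Q.LiesOver (span {(p : ℤ)})) (φ : N ≃ₐ[ℚ] N),
            IsArithFrobAt ℤ φ Q ∧ Q.inertia (N ≃ₐ[ℚ] N) = ⊥ ∧ φ ∈ S), Real.log p) -
        ∑ p ∈ (Nat.primesLE ⌊x⌋₊).filter (fun p : ℕ => ¬ ((p : ℤ) ∣ NumberField.discr N) ∧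
          ∃ (Q : Ideal (𝓞 N)) (_ : Q.IsMaximal) (_ : Q.LiesOver (span {(p : ℤ)})) (φ : N ≃ₐ[ℚ] N),
            IsArithFrobAt ℤ φ Q ∧ Q.inertia (N ≃ₐ[ℚ] N) = ⊥ ∧ φ ∈ S), Real.log p)| ≤ Real.log d := by
    refine le_trans (abs_windowSum_sub_windowSum_le hsub P (fun p : ℕ => ¬ ((p : ℤ) ∣ NumberField.discr N) ∧
          ∃ (Q : Ideal (𝓞 N)) (_ : Q.IsMaximal) (_ : Q.LiesOver (span {(p : ℤ)})) (φ : N ≃ₐ[ℚ] N),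
            IsArithFrobAt ℤ φ Q ∧ Q.inertia (N ≃ₐ[ℚ] N) = ⊥ ∧ φ ∈ S)
      (fun p : ℕ => (p : ℤ) ∣ NumberField.discr N) (f := fun p : ℕ => Real.log p)
      (fun p => Real.log_natCast_nonneg p) fun p hp hR => ?_) ?_
    · rw [hP p (Nat.mem_primesLE.mp hp).2 hR]
      exact ⟨fun h1 => ⟨hR, h1⟩, fun h1 => h1.2⟩
    · exact sum_primesLE_filter_dvd_discr_log_le N ⌊x + h⌋₊
  -- lower bound for the main term: `M ≥ (h/2n) q`
  have hS1 : (1 : ℝ) ≤ Nat.card S := by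
    haveI : Nonempty S := hSne.to_subtype
    exact_mod_cast Nat.one_le_iff_ne_zero.mpr (Nat.card_pos (α := S)).ne'
  have hcs : (Nat.card S : ℝ) = (Nat.card {g : N ≃ₐ[ℚ] N // g ∈ S ∧ g ∈ K₁} : ℝ) +
      Nat.card {g : N ≃ₐ[ℚ] N // g ∈ S ∧ g ∉ K₁} := by
    exact_mod_cast natCard_set_eq_add S K₁
  have hSp0 : (0 : ℝ) ≤ Nat.card {g : N ≃ₐ[ℚ] N // g ∈ S ∧ g ∈ K₁} := Nat.cast_nonneg _
  have hSm0 : (0 : ℝ) ≤ Nat.card {g : N ≃ₐ[ℚ] N // g ∈ S ∧ g ∉ K₁} := Nat.cast_nonneg _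
  have hMlow : h / (2 * n) * q ≤ M := by
    rcases hθ with hθ0 | hθ1
    · -- `θ = 0`: `M = |S| h / n ≥ h/n ≥ (h/2n) q`
      have eM : M = (Nat.card S : ℝ) * h / n := by rw [hM, hθ0, hG]; ring
      rw [eM]
      have h2 : h / (2 * n) * q ≤ h / n := by
        rw [div_mul_eq_mul_div, mul_comm (2 : ℝ), ← div_div]
        have : h * q / n ≤ h / n := div_le_div_of_nonneg_right (by nlinarith) hn0.le
        have h3 : h * q / n / 2 ≤ h * q / n := by
          have : 0 ≤ h * q / n := by positivity
          linarith
        exact h3.trans this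
      refine h2.trans ?_
      exact div_le_div_of_nonneg_right (by nlinarith) hn0.le
    · -- `θ = 1`: Stark + `half_min_mul_le_flat`
      obtain ⟨hζ, -, -⟩ := h1 hθ1
      have hℓ : 1 < Real.log d + Real.log 4 := by
        have h1' := Real.log_pos (by linarith : (1 : ℝ) < d)
        have h2 : 1 < Real.log 4 := by
          have h' := Real.log_two_gt_d9
          have e4 : Real.log 4 = 2 * Real.log 2 := by
            rw [show (4 : ℝ) = 2 ^ 2 by norm_num, Real.log_pow]; push_cast; ring
          rw [e4]; linarith
        linarith
      have hβ₁0 : 0 < β₁ := by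
        have : c / (Real.log d + Real.log 4) < 1 := by
          rw [div_lt_one (by linarith)]; linarith
        linarith
      set I : ℝ := ((x + h) ^ β₁ - x ^ β₁) / β₁ with hI
      have hI0 : 0 ≤ I := (rpow_window_div_mem hx1 hh0 hβ₁0 hβ₁1.le).1
      have hflat := half_min_mul_le_flat hx1 hh0 hβ₁0 hβ₁1
      -- Stark: `q ≤ 1 − β₁ ≤ min(1, (1−β₁) log x)`
      have hβ1ne : ((β₁ : ℝ) : ℂ) ≠ 1 := by
        intro h'; apply hβ₁1.ne; exact_mod_cast h'
      have hLzero : classGroupLFunction N 1 β₁ = 0 := by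
        have := classGroupLFunction_eq_zero_of_famF (K := N) 0 (ρ := (β₁ : ℂ))
          (by rw [famF_zero]; exact hζ) hβ1ne
        rwa [toHomUnits_toMulHom_zero] at this
      have h11 : (1 : ClassGroup (𝓞 N) →* ℂˣ) * 1 = 1 := by ext; simp
      have hδlow : q ≤ 1 - β₁ := heff N hN 1 h11 β₁ hβ₁1 hLzero
      have hlogx1 : 1 ≤ Real.log x := by
        rw [Real.le_log_iff_exp_le hx0]
        have := Real.exp_one_lt_d9; linarith
      have hμlow : q ≤ min 1 ((1 - β₁) * Real.log x) := by
        refine le_min hq1 ?_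
        calc q ≤ (1 - β₁) * 1 := by linarith
          _ ≤ (1 - β₁) * Real.log x := mul_le_mul_of_nonneg_left hlogx1 (by linarith)
      have hhI : h / 2 * q ≤ h - I := by
        have := mul_le_mul_of_nonneg_left hμlow (by positivity : 0 ≤ h / 2)
        exact this.trans hflat
      -- `M = (|S∩K₁|(h−I) + |S∖K₁|(h+I))/n ≥ |S|(h−I)/n ≥ (h−I)/n`
      have eM : M = ((Nat.card {g : N ≃ₐ[ℚ] N // g ∈ S ∧ g ∈ K₁} : ℝ) * (h - I) +
          (Nat.card {g : N ≃ₐ[ℚ] N // g ∈ S ∧ g ∉ K₁} : ℝ) * (h + I)) / n := by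
        rw [hM, hθ1, hG, hcs]; ring
      rw [eM, le_div_iff₀ hn0]
      have hhI0 : 0 ≤ h - I := le_trans (by positivity) hhI
      calc h / (2 * n) * q * n = h / 2 * q := by field_simp
        _ ≤ h - I := hhI
        _ ≤ (Nat.card S : ℝ) * (h - I) := by nlinarith
        _ = (Nat.card {g : N ≃ₐ[ℚ] N // g ∈ S ∧ g ∈ K₁} : ℝ) * (h - I) +
            (Nat.card {g : N ≃ₐ[ℚ] N // g ∈ S ∧ g ∉ K₁} : ℝ) * (h - I) := by rw [hcs]; ring
        _ ≤ (Nat.card {g : N ≃ₐ[ℚ] N // g ∈ S ∧ g ∈ K₁} : ℝ) * (h - I) +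
            (Nat.card {g : N ≃ₐ[ℚ] N // g ∈ S ∧ g ∉ K₁} : ℝ) * (h + I) := by nlinarith
  -- absorb: `log d ≤ (κ'/4) q h = (κ/2)·((h/2n) q) ≤ (κ/2) M`
  have habs : Real.log d ≤ κ / 2 * M := by
    have e1 : κ' / 4 * q * h = κ / 2 * (h / (2 * n) * q) := by rw [hκ']; field_simp; ring
    rw [e1] at hlogd
    exact hlogd.trans (mul_le_mul_of_nonneg_left hMlow hκ2.le)
  -- combine
  have hfin : |(∑ p ∈ (Nat.primesLE ⌊x + h⌋₊).filter P, Real.log p) -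
      (∑ p ∈ (Nat.primesLE ⌊x⌋₊).filter P, Real.log p) - M| ≤ κ * M := by
    have htri : |(∑ p ∈ (Nat.primesLE ⌊x + h⌋₊).filter P, Real.log p) -
        (∑ p ∈ (Nat.primesLE ⌊x⌋₊).filter P, Real.log p) - M| ≤
        |((∑ p ∈ (Nat.primesLE ⌊x + h⌋₊).filter P, Real.log p) -
            ∑ p ∈ (Nat.primesLE ⌊x⌋₊).filter P, Real.log p) -
          ((∑ p ∈ (Nat.primesLE ⌊x + h⌋₊).filter (fun p : ℕ => ¬ ((p : ℤ) ∣ NumberField.discr N) ∧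
          ∃ (Q : Ideal (𝓞 N)) (_ : Q.IsMaximal) (_ : Q.LiesOver (span {(p : ℤ)})) (φ : N ≃ₐ[ℚ] N),
            IsArithFrobAt ℤ φ Q ∧ Q.inertia (N ≃ₐ[ℚ] N) = ⊥ ∧ φ ∈ S), Real.log p) -
            ∑ p ∈ (Nat.primesLE ⌊x⌋₊).filter (fun p : ℕ => ¬ ((p : ℤ) ∣ NumberField.discr N) ∧
          ∃ (Q : Ideal (𝓞 N)) (_ : Q.IsMaximal) (_ : Q.LiesOver (span {(p : ℤ)})) (φ : N ≃ₐ[ℚ] N),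
            IsArithFrobAt ℤ φ Q ∧ Q.inertia (N ≃ₐ[ℚ] N) = ⊥ ∧ φ ∈ S), Real.log p)| +
        |(∑ p ∈ (Nat.primesLE ⌊x + h⌋₊).filter (fun p : ℕ => ¬ ((p : ℤ) ∣ NumberField.discr N) ∧
          ∃ (Q : Ideal (𝓞 N)) (_ : Q.IsMaximal) (_ : Q.LiesOver (span {(p : ℤ)})) (φ : N ≃ₐ[ℚ] N),
            IsArithFrobAt ℤ φ Q ∧ Q.inertia (N ≃ₐ[ℚ] N) = ⊥ ∧ φ ∈ S), Real.log p) -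
            (∑ p ∈ (Nat.primesLE ⌊x⌋₊).filter (fun p : ℕ => ¬ ((p : ℤ) ∣ NumberField.discr N) ∧
          ∃ (Q : Ideal (𝓞 N)) (_ : Q.IsMaximal) (_ : Q.LiesOver (span {(p : ℤ)})) (φ : N ≃ₐ[ℚ] N),
            IsArithFrobAt ℤ φ Q ∧ Q.inertia (N ≃ₐ[ℚ] N) = ⊥ ∧ φ ∈ S), Real.log p) - M| := by
      have := abs_sub_le ((∑ p ∈ (Nat.primesLE ⌊x + h⌋₊).filter P, Real.log p) -
          ∑ p ∈ (Nat.primesLE ⌊x⌋₊).filter P, Real.log p)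
        ((∑ p ∈ (Nat.primesLE ⌊x + h⌋₊).filter (fun p : ℕ => ¬ ((p : ℤ) ∣ NumberField.discr N) ∧
          ∃ (Q : Ideal (𝓞 N)) (_ : Q.IsMaximal) (_ : Q.LiesOver (span {(p : ℤ)})) (φ : N ≃ₐ[ℚ] N),
            IsArithFrobAt ℤ φ Q ∧ Q.inertia (N ≃ₐ[ℚ] N) = ⊥ ∧ φ ∈ S), Real.log p) -
          ∑ p ∈ (Nat.primesLE ⌊x⌋₊).filter (fun p : ℕ => ¬ ((p : ℤ) ∣ NumberField.discr N) ∧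
          ∃ (Q : Ideal (𝓞 N)) (_ : Q.IsMaximal) (_ : Q.LiesOver (span {(p : ℤ)})) (φ : N ≃ₐ[ℚ] N),
            IsArithFrobAt ℤ φ Q ∧ Q.inertia (N ≃ₐ[ℚ] N) = ⊥ ∧ φ ∈ S), Real.log p) M
      convert this using 2
    have hk : |(∑ p ∈ (Nat.primesLE ⌊x + h⌋₊).filter (fun p : ℕ => ¬ ((p : ℤ) ∣ NumberField.discr N) ∧
          ∃ (Q : Ideal (𝓞 N)) (_ : Q.IsMaximal) (_ : Q.LiesOver (span {(p : ℤ)})) (φ : N ≃ₐ[ℚ] N),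
            IsArithFrobAt ℤ φ Q ∧ Q.inertia (N ≃ₐ[ℚ] N) = ⊥ ∧ φ ∈ S), Real.log p) -
        (∑ p ∈ (Nat.primesLE ⌊x⌋₊).filter (fun p : ℕ => ¬ ((p : ℤ) ∣ NumberField.discr N) ∧
          ∃ (Q : Ideal (𝓞 N)) (_ : Q.IsMaximal) (_ : Q.LiesOver (span {(p : ℤ)})) (φ : N ≃ₐ[ℚ] N),
            IsArithFrobAt ℤ φ Q ∧ Q.inertia (N ≃ₐ[ℚ] N) = ⊥ ∧ φ ∈ S), Real.log p) - M| ≤ κ / 2 * M := key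
    calc _ ≤ _ := htri
      _ ≤ Real.log d + κ / 2 * M := add_le_add hpert hk
      _ ≤ κ / 2 * M + κ / 2 * M := by linarith
      _ = κ * M := by ring
  rw [hM] at hfin
  exact hfin

end Summit.QuantumAdvantage.QuantumAdvantage.Theorems.DegreeOnePrimesEscape

end
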